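import Summits.QuantumFields.YangMills.Theorems.BalabanUVNodesN18StationaryKernelOfKernelLetters
import Literature.MathematicalPhysics.QuantumFieldTheory.Balaban1983to89.B12Limit51

/-!
# BalabanUVNodes ∕ N18 — THE STATIONARY KERNEL OF THE MERGED TERM's (1.21) KERNELS, FILE 2: THE UV CORNER FACE (along the diagonal `(t,t,…)` the iterated limits `k → ∞` ∕ `t → 0⁺`
# COMMUTE — `Π_∞(t,t,…) → Π⁰_∞`, g4 FILE 3's limit kernel, and `betaInf (betaMerged …)(t,t,…) →` g4's corner limit number, with LINEAR rates in `t`) AND THE RECORD EDITIONS at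
# `objectsOfRecord₁₃ F N θ ℓ` (K3⁷ v5 pin currency: the stationary kernel of record, its tail ∕ (5.10) class ∕ memory profile, (1.22) AT LEVEL ∞ for `betaOfRecord₁₃ F N θ`, and the
# corner commutation for the β of record)
# (Track A, DAG node N18 = NE5; cluster K4 «SpineRates»; key K3⁷ `SpineGivenEndpointR13SepCoPH` = stmt-QuantumFields-20544, skeleton v5 941dddb108cbaacf; width seat `pub-ymgap-dag-n18-w1` g5,
# FILE 2 of 2 — FILE 1 `…N18StationaryKernelOfKernelLetters` (§1–§4: entrywise `ScaleShiftRate`, the stationary kernel `Π_∞(h)`, its memory profile, (1.22) at level ∞))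

HONEST FRAMING.  Count-neutral kernel bookkeeping BY NAME (`--kind proof --supports stmt-QuantumFields-20544 --as helper`).  Elementary real analysis — uniqueness of limits along
`𝓝[>] 0` and `atTop`, squeeze, dominated summation (pv10∕t4 `secondMoment_sub_abs_le`) — over LANDED tree lemmas cited by name: FILE 1 (`tendsto_kernelEntry_revHist_stationary`,
`abs_kernelEntry_revHist_sub_stationary_le`, `decay510_stationaryKernel`, `exists_decay510_stationaryKernel_of_kernelDecay`, `memoryProfile_stationaryKernel_of_ne9`,
`tendsto_betaMerged_revHist_secondMoment_stationaryKernel`, `betaInf_betaMerged_eq_secondMoment_stationaryKernel`, `extd_revHist_const`), this seat's g4 FILE 1 ∕ FILE 3 (`const_mem_box`,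
`sum_abs_moduli_le_of_fadingMemory`, `extd_const`, `const_mem_window`, `exists_cornerKernels_of_ne9`, `decay510_cornerKernel`, `abs_cornerKernel_step_le_of_kernelStepRate`,
`exists_limitKernel_of_cornerStep`, `betaPrime510_eq_mul`, `cornerNumber_eq_secondMoment_cornerKernel`, `abs_cornerMoment_sub_limitMoment_le`), dag-n22-w3's
`fadingMemory_histModuli_of_fadingMemory`, def-B's `betaOfMerged_of_mem`, pv's `B12Limit51.decay510_of_tendsto`, P1's `T4BetaStationary` (`SeqBox`, `revHist`, `betaInf`, `revHist_mem_box`).  `KernelStepRate` (N18's input — NE5 NOT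
PRINTED for d = 4), kernel NE9 + fading memory (N22's input) and the (5.10) clause ((D4)'s input) are DISPLAYED HYPOTHESES — nothing of Bałaban's is asserted, inhabited or discharged;
g4's corner kernels ∕ limit kernel ∕ corner numbers enter in HYPOTHESIS FORM characterised by their limits (which are unique) or are ∃-produced inside proofs from g4's lemmas; NO value,
sign or identification of `Π⁰_∞`, of the corner limit number or of `betaInf` is claimed — K2's one bit (the corner sign) is NOT touched; N17 ∕ N18 ∕ N22 NOT discharged; K3⁷ OPEN (v5),
`stub_rates13H` ∕ `stub_expansion13H` NOT proved.  Counts UNMOVED (typed 28∕28 · discharged 5∕27, A 5∕28).  One finite four-torus programme at fixed `ε`, Bałaban AS PRINTED; route R4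
closes ONLY the conditional finite-𝕋⁴ rung `BalabanLadder.UV` — NOT the continuum limit, NOT ℝ⁴, NOT OS, NOT the Yang–Mills mass gap, NOT Clay.  THEOREMS ONLY: 0 `def`, 0 `instance`,
0 `sorry`, standard axioms.

WHY.  FILE 1 made node U2's continuum functional of the merged β the (1.22) second moment of ONE stationary kernel `Π_∞(h)` per reversed history (from N18's letter + the (5.10) class),
with N22's fading memory as its memory profile.  The box-valued histories exclude the zero history; g4's CORNER objects live exactly there, as one-sided limits `t → 0⁺` at FIXED level
followed by `k → ∞` (corner kernels `Π⁰_k`, limit kernel `Π⁰_∞`, corner numbers `c_k` and their limit `c_∞` — the number whose SIGN is K2's one bit, idea-7's `L_∞`).  §5 closes the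
square: along the diagonal `(t,t,…)` the OTHER order of limits (first `k → ∞` — FILE 1's `Π_∞(t,t,…)` ∕ `betaInf (betaMerged …)(t,t,…)` — then `t → 0⁺`) gives the SAME kernel and the
SAME number, at a rate LINEAR in `t` whose constant `C₉ω(1−ω)⁻¹` is N22's k-uniform total memory (fading memory is what makes the band uniform in the level, hence exchangeable with
the level limit).  So «the UV corner value of the continuum functional» (idea-7's `CornerLimitSignSketch` §5, there from N17 + an anchor at the β level) is reached here by the KERNEL
road from the three kernel letters, and equals g4's `c_∞ = secondMoment Π⁰_∞ 0 1`.  §6 reads everything at the objects of record under K3⁷ v5's pin.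

WHAT (theorems only).  §5 generic term family: ★ `abs_stationaryKernel_const_sub_limitKernel_le` (`|Π_∞(t,t,…)(z) − Π⁰_∞(z)| ≤ e^{−κ|z|₁}·(C₉ω(1−ω)⁻¹)·t`) ·
`tendsto_stationaryKernel_const_limitKernel` · ★ `abs_betaInf_betaMerged_const_sub_limitMoment_le` (`≤ (C₉ω(1−ω)⁻¹)·betaPrime510 4 1 κ·t`) · `tendsto_betaInf_betaMerged_const_limitMoment` ·
★★ `tendsto_betaInf_betaMerged_const_of_cornerNumbers` (THE ITERATED CORNER LIMITS OF THE MERGED β COMMUTE: `β_{k+1}(t,…,t) → c_k` (t → 0⁺) and `c_k → c_∞` ⟹ `betaInf (betaMerged …)(t,t,…) → c_∞`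
(t → 0⁺)).  §6 AT THE RECORD: ★★ `stationaryKernel_record_of_kernelLetters` (∃ ONE kernel functional `Π_∞` of record: convergence ∕ tail `ℓ.C₅ℓ.θ₅^{k+1}e^{−ℓ.κ|z|₁}∕(1−ℓ.θ₅)` ∕ (5.10) class ∕
memory `e^{−ℓ.κ|z|₁}ℓ.C₉ℓ.ω·Σ'ℓ.ω^j|h j − h′ j|` ∕ `betaOfRecord₁₃ F N θ k (revHist h k) → secondMoment (Π_∞ h) 0 1 = betaInf (betaOfRecord₁₃ F N θ) h`) · ★★
`tendsto_betaInf_betaOfRecord₁₃_const_of_cornerNumbers` (the corner commutation for the β of record; g4 FILE 3's `cornerNumbers_record_geometric_of_kernelLetters` supplies `c`, `c_∞`).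

References (TYPES ∕ locators only): [Balaban1987RG1] CMP **109** (1987): p. 255 (one β-function: motivation only), Thm 1 p. 259 (NE5 NOT printed), (1.18) p. 263, (1.20)–(1.22)
p. 264, (2.12)–(2.14) p. 268, §5 p. 298, (5.10) p. 293, (5.42) p. 297.
-/

noncomputable section

open Filter Topology
open scoped BigOperators

namespace YMDAG.N18.StationaryKernelOfKernelLetters

open Literature.MathematicalPhysics.QuantumFieldTheory.Balaban1983to89
open Literature.MathematicalPhysics.QuantumFieldTheory.Balaban1983to89.T4Continuum (T4Family)
open Literature.MathematicalPhysics.QuantumFieldTheory.Balaban1983to89.T4OutputRate (Window NE9)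
open Literature.MathematicalPhysics.QuantumFieldTheory.Balaban1983to89.FlowStep (Box mem_box)
open Literature.MathematicalPhysics.QuantumFieldTheory.Balaban1983to89.B12Beta (secondMoment)
open Literature.MathematicalPhysics.QuantumFieldTheory.Balaban1983to89.T4CouplingMatching (FadingMemory)
open Literature.MathematicalPhysics.QuantumFieldTheory.Balaban1983to89.T4FlagMemory (extd)
open Literature.MathematicalPhysics.QuantumFieldTheory.Balaban1983to89.T4BetaReadOut (extd_mem_window)
open Literature.MathematicalPhysics.QuantumFieldTheory.Balaban1983to89.T4BetaReadOutLipschitz (secondMoment_sub_abs_le)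
open Literature.MathematicalPhysics.QuantumFieldTheory.Balaban1983to89.T4BetaStationary (SeqBox revHist betaInf revHist_mem_box)
open Literature.MathematicalPhysics.QuantumFieldTheory.Balaban1983to89.Node00 (TermFamily1 betaMerged mergedTermFamilyMatT TβOfRecord₁₃ chiβOfRecord₁₃ betaOfRecord₁₃ Stage13Params
  U3Letters₁₁)
open Literature.MathematicalPhysics.QuantumFieldTheory.Balaban1983to89.Node00.U3OfKernels (kernelA EA KernelDecay objectsOfRecord₁₃ KernelDecayOfRecord₁₃)
open Literature.MathematicalPhysics.QuantumFieldTheory.Balaban1983to89.Node00.U3KernelLetters (KernelStepRate KernelStepRateOfRecord₁₃)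
open Literature.MathematicalPhysics.QuantumFieldTheory.Balaban1983to89.B12Sec2to5 (l1 Decay510 betaPrime510)
open YMDAG.N22.AtKernels (fadingMemory_histModuli_of_fadingMemory)
open YMDAG.N18.CornerBandOfKernelLetters (const_mem_box sum_abs_moduli_le_of_fadingMemory)
open YMDAG.N18.CornerKernelsOfKernelLetters (extd_const const_mem_window exists_cornerKernels_of_ne9 decay510_cornerKernel abs_cornerKernel_step_le_of_kernelStepRate
  exists_limitKernel_of_cornerStep betaPrime510_eq_mul cornerNumber_eq_secondMoment_cornerKernel abs_cornerMoment_sub_limitMoment_le)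

variable {𝔄 : Type*} [NormedRing 𝔄] [NormedAlgebra ℝ 𝔄]
variable {V : Type*} [NormedAddCommGroup V] [NormedSpace ℝ V] {ι : Type*} [Fintype ι]
variable (F : T4Family) (ℰ : TermFamily1 F 𝔄) (ρ : V →L[ℝ] 𝔄) (bV : Module.Basis ι ℝ V)

/-! ## §5 THE CORNER FACE: along the diagonal `(t,t,…)` the iterated limits `k → ∞` ∕ `t → 0⁺` COMMUTE — junction with g4 FILE 3's corner kernels `Π⁰_k`, limit kernel `Π⁰_∞`
and corner numbers (all ∃-produced there; here characterised by their limits, which are unique) -/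

/-- ★ **THE STATIONARY KERNEL AT THE CONSTANT HISTORY `t` vs g4's LIMIT KERNEL**: with kernel NE9 + fading memory (`0 ≤ ω < 1`, for the k-UNIFORM band `e^{−κ|z|₁}·(C₉ω(1−ω)⁻¹)·t` between
`Π_{k+1}(t,…,t; z)` and the corner kernel `Π⁰_k(z)`), N18's letter (`θ < 1`, for the two level limits) and `0 < γ`: if `Π⁰_k` are the corner kernels (`Π_{k+1}(t,…,t; z) → Π⁰_k(z)` as
`t → 0⁺`) and `Π⁰_k → Π⁰_∞` pointwise, then `|Π_∞(t,t,…)(μ,ν,z) − Π⁰_∞(μ,ν,z)| ≤ e^{−κ|z|₁}·(C₉ω(1−ω)⁻¹)·t` for every `t ∈ ]0,γ]` — the two iterated limits of `Π_{k+1}(t,…,t; z)` agree.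
[cite: Balaban1987RG1, (1.20)-(1.21) p.264, (2.12)-(2.14) p.268 and §5 p.298] -/
theorem abs_stationaryKernel_const_sub_limitKernel_le {γ κ θ C₅ C₉ ω : ℝ} {Λ : ℕ → ℕ → ℝ} (hγ : 0 < γ) (h9 : NE9 (EA F ℰ ρ bV) (Window γ) κ Λ)
    (hF : T4OutputRate.FadingMemory C₉ ω Λ) (hω0 : 0 ≤ ω) (hω1 : ω < 1) (h18 : KernelStepRate F ℰ ρ bV γ κ θ C₅) (hθ1 : θ < 1)
    {P0 : ℕ → B12Beta.Kernel 4}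
    (hP : ∀ (k : ℕ) (μ ν : Fin 4) (z : Fin 4 → ℤ), Tendsto (fun t : ℝ => kernelA F ℰ ρ bV (fun _ : ℕ => t) k μ ν z) (𝓝[>] (0 : ℝ)) (𝓝 (P0 k μ ν z)))
    {Pinf : B12Beta.Kernel 4} (hPinf : ∀ (μ ν : Fin 4) (z : Fin 4 → ℤ), Tendsto (fun k : ℕ => P0 k μ ν z) atTop (𝓝 (Pinf μ ν z)))
    {t : ℝ} (ht : t ∈ Set.Ioc 0 γ) (μ ν : Fin 4) (z : Fin 4 → ℤ) :
    |betaInf (fun k v => kernelA F ℰ ρ bV (extd v) k μ ν z) (fun _ : ℕ => t) - Pinf μ ν z| ≤ Real.exp (-(κ * l1 z)) * (C₉ * ω * (1 - ω)⁻¹) * t := by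
  -- g4's corner kernels with their band; they coincide with `P0` (limits along `𝓝[>] 0` are unique)
  obtain ⟨P0', hT', hband'⟩ := exists_cornerKernels_of_ne9 F ℰ ρ bV hγ h9
  have heq : ∀ (k : ℕ) (μ ν : Fin 4) (z : Fin 4 → ℤ), P0' k μ ν z = P0 k μ ν z := fun k μ ν z => tendsto_nhds_unique (hT' k μ ν z) (hP k μ ν z)
  have hF' : FadingMemory (C₉ * ω) ω (fun k i => Λ (k + 1) i) := by
    have e := fadingMemory_histModuli_of_fadingMemory (M := 1) (Λ := Λ) zero_le_one hF
    simpa only [one_mul] using e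
  have hh : SeqBox γ (fun _ : ℕ => t) := fun _ => ht
  have ha := tendsto_kernelEntry_revHist_stationary F ℰ ρ bV h18 hθ1 hh μ ν z
  refine le_of_tendsto' ((ha.sub (hPinf μ ν z)).abs) fun k => ?_
  have e := hband' k μ ν z (fun _ => t) (const_mem_box ht)
  rw [extd_const, ← Finset.sum_mul, heq] at e
  have hsum : (∑ i : Fin (k + 1), |Λ (k + 1) i|) * t ≤ (C₉ * ω * (1 - ω)⁻¹) * t :=
    mul_le_mul_of_nonneg_right (sum_abs_moduli_le_of_fadingMemory hF' hω0 hω1 k) ht.1.le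
  show |kernelA F ℰ ρ bV (extd (revHist (fun _ : ℕ => t) k)) k μ ν z - P0 k μ ν z| ≤ _
  rw [extd_revHist_const]
  calc |kernelA F ℰ ρ bV (fun _ : ℕ => t) k μ ν z - P0 k μ ν z| ≤ Real.exp (-(κ * l1 z)) * ((∑ i : Fin (k + 1), |Λ (k + 1) i|) * t) := e
    _ ≤ Real.exp (-(κ * l1 z)) * ((C₉ * ω * (1 - ω)⁻¹) * t) := mul_le_mul_of_nonneg_left hsum (Real.exp_nonneg _)
    _ = Real.exp (-(κ * l1 z)) * (C₉ * ω * (1 - ω)⁻¹) * t := by ring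

/-- Hence `Π_∞(t,t,…)(μ,ν,z) → Π⁰_∞(μ,ν,z)` as `t → 0⁺`: the stationary kernel is CONTINUOUS AT THE UV CORNER along the diagonal, with g4's limit kernel as its corner value.
[cite: Balaban1987RG1, (1.20)-(1.21) p.264 and (2.12)-(2.14) p.268] -/
theorem tendsto_stationaryKernel_const_limitKernel {γ κ θ C₅ C₉ ω : ℝ} {Λ : ℕ → ℕ → ℝ} (hγ : 0 < γ) (h9 : NE9 (EA F ℰ ρ bV) (Window γ) κ Λ)
    (hF : T4OutputRate.FadingMemory C₉ ω Λ) (hω0 : 0 ≤ ω) (hω1 : ω < 1) (h18 : KernelStepRate F ℰ ρ bV γ κ θ C₅) (hθ1 : θ < 1)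
    {P0 : ℕ → B12Beta.Kernel 4}
    (hP : ∀ (k : ℕ) (μ ν : Fin 4) (z : Fin 4 → ℤ), Tendsto (fun t : ℝ => kernelA F ℰ ρ bV (fun _ : ℕ => t) k μ ν z) (𝓝[>] (0 : ℝ)) (𝓝 (P0 k μ ν z)))
    {Pinf : B12Beta.Kernel 4} (hPinf : ∀ (μ ν : Fin 4) (z : Fin 4 → ℤ), Tendsto (fun k : ℕ => P0 k μ ν z) atTop (𝓝 (Pinf μ ν z)))
    (μ ν : Fin 4) (z : Fin 4 → ℤ) :
    Tendsto (fun t : ℝ => betaInf (fun k v => kernelA F ℰ ρ bV (extd v) k μ ν z) (fun _ : ℕ => t)) (𝓝[>] (0 : ℝ)) (𝓝 (Pinf μ ν z)) := by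
  have key : ∀ᶠ t in 𝓝[>] (0 : ℝ), ‖betaInf (fun k v => kernelA F ℰ ρ bV (extd v) k μ ν z) (fun _ : ℕ => t) - Pinf μ ν z‖ ≤
      Real.exp (-(κ * l1 z)) * (C₉ * ω * (1 - ω)⁻¹) * t := by
    filter_upwards [Ioc_mem_nhdsGT hγ] with t ht
    rw [Real.norm_eq_abs]
    exact abs_stationaryKernel_const_sub_limitKernel_le F ℰ ρ bV hγ h9 hF hω0 hω1 h18 hθ1 hP hPinf ht μ ν z
  have h0 : Tendsto (fun t : ℝ => Real.exp (-(κ * l1 z)) * (C₉ * ω * (1 - ω)⁻¹) * t) (𝓝[>] (0 : ℝ)) (𝓝 0) := by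
    have h : Tendsto (fun t : ℝ => Real.exp (-(κ * l1 z)) * (C₉ * ω * (1 - ω)⁻¹) * t) (𝓝 (0 : ℝ))
        (𝓝 (Real.exp (-(κ * l1 z)) * (C₉ * ω * (1 - ω)⁻¹) * 0)) := (continuous_const.mul continuous_id).tendsto 0
    rw [mul_zero] at h
    exact h.mono_left nhdsWithin_le_nhds
  exact tendsto_sub_nhds_zero_iff.1 (squeeze_zero_norm' key h0)

/-- ★ **β LEVEL: node U2's functional of the merged β AT THE CONSTANT HISTORY `t` vs THE SECOND MOMENT OF g4's LIMIT KERNEL** (+ `0 < κ` and the (5.10) clause on the window):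
`|betaInf (betaMerged F ℰ ρ bV) (t,t,…) − secondMoment Π⁰_∞ 0 1| ≤ (C₉ω(1−ω)⁻¹)·betaPrime510 4 1 κ·t` — linear in `t`.  The second moment `secondMoment Π⁰_∞ 0 1` is g4 FILE 3's corner limit
number (`abs_cornerMoment_sub_limitMoment_le`); its VALUE ∕ SIGN is NOT claimed. [cite: Balaban1987RG1, (1.22) p.264, (2.12)-(2.14) p.268 and (5.10) p.293] -/
theorem abs_betaInf_betaMerged_const_sub_limitMoment_le {γ κ θ C₅ C₉ ω : ℝ} {Λ : ℕ → ℕ → ℝ} (hγ : 0 < γ) (hκ : 0 < κ) (h9 : NE9 (EA F ℰ ρ bV) (Window γ) κ Λ)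
    (hF : T4OutputRate.FadingMemory C₉ ω Λ) (hω0 : 0 ≤ ω) (hω1 : ω < 1) (h18 : KernelStepRate F ℰ ρ bV γ κ θ C₅) (hθ0 : 0 ≤ θ) (hθ1 : θ < 1)
    (hdec : KernelDecay F ℰ ρ bV (Window γ) 0 1 κ) {P0 : ℕ → B12Beta.Kernel 4}
    (hP : ∀ (k : ℕ) (μ ν : Fin 4) (z : Fin 4 → ℤ), Tendsto (fun t : ℝ => kernelA F ℰ ρ bV (fun _ : ℕ => t) k μ ν z) (𝓝[>] (0 : ℝ)) (𝓝 (P0 k μ ν z)))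
    {Pinf : B12Beta.Kernel 4} (hPinf : ∀ (μ ν : Fin 4) (z : Fin 4 → ℤ), Tendsto (fun k : ℕ => P0 k μ ν z) atTop (𝓝 (Pinf μ ν z)))
    {t : ℝ} (ht : t ∈ Set.Ioc 0 γ) :
    |betaInf (betaMerged F ℰ ρ bV) (fun _ : ℕ => t) - secondMoment Pinf 0 1| ≤ (C₉ * ω * (1 - ω)⁻¹) * betaPrime510 4 1 κ * t := by
  have hh : SeqBox γ (fun _ : ℕ => t) := fun _ => ht
  rw [betaInf_betaMerged_eq_secondMoment_stationaryKernel F ℰ ρ bV hκ h18 hθ0 hθ1 hdec hh]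
  -- (5.10) constants: the stationary kernel (§2), the corner kernels UNIFORMLY (g4 FILE 3's `decay510_cornerKernel` + fading memory), hence the limit kernel
  obtain ⟨C0, hC0⟩ := hdec (extd (revHist (fun _ : ℕ => t) 0)) (extd_mem_window (revHist_mem_box hh 0))
  have hS : Decay510 ((fun μ ν z => betaInf (fun k v => kernelA F ℰ ρ bV (extd v) k μ ν z) (fun _ : ℕ => t)) 0 1) (C0 + C₅ * θ / (1 - θ)) κ :=
    decay510_stationaryKernel F ℰ ρ bV h18 hθ1 hh (hC0 0)
  obtain ⟨P0', hT', hband'⟩ := exists_cornerKernels_of_ne9 F ℰ ρ bV hγ h9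
  have heq : ∀ (k : ℕ) (μ ν : Fin 4) (z : Fin 4 → ℤ), P0' k μ ν z = P0 k μ ν z := fun k μ ν z => tendsto_nhds_unique (hT' k μ ν z) (hP k μ ν z)
  have hF' : FadingMemory (C₉ * ω) ω (fun k i => Λ (k + 1) i) := by
    have e := fadingMemory_histModuli_of_fadingMemory (M := 1) (Λ := Λ) zero_le_one hF
    simpa only [one_mul] using e
  obtain ⟨Cγ, hCγ⟩ := hdec (fun _ => γ) (const_mem_window ⟨hγ, le_rfl⟩)
  have hP0 : ∀ k : ℕ, Decay510 (P0 k 0 1) (Cγ + (C₉ * ω * (1 - ω)⁻¹) * γ) κ := fun k z => by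
    have h1 := decay510_cornerKernel F ℰ ρ bV hγ hband' (hCγ k) z
    rw [heq] at h1
    refine h1.trans (mul_le_mul_of_nonneg_right ?_ (Real.exp_nonneg _))
    have := sum_abs_moduli_le_of_fadingMemory hF' hω0 hω1 k
    nlinarith [hγ.le]
  have hI : Decay510 (Pinf 0 1) (Cγ + (C₉ * ω * (1 - ω)⁻¹) * γ) κ := B12Limit51.decay510_of_tendsto (fun k => P0 k 0 1) (Pinf 0 1) _ _ hP0 (hPinf 0 1)
  have hD : Decay510 (fun z => (fun μ ν z => betaInf (fun k v => kernelA F ℰ ρ bV (extd v) k μ ν z) (fun _ : ℕ => t)) 0 1 z - Pinf 0 1 z)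
      ((C₉ * ω * (1 - ω)⁻¹) * t) κ := by
    intro z
    rw [neg_mul]
    refine (abs_stationaryKernel_const_sub_limitKernel_le F ℰ ρ bV hγ h9 hF hω0 hω1 h18 hθ1 hP hPinf ht 0 1 z).trans (le_of_eq ?_)
    ring
  have e := secondMoment_sub_abs_le (Pk := fun μ ν z => betaInf (fun k v => kernelA F ℰ ρ bV (extd v) k μ ν z) (fun _ : ℕ => t)) (Pk' := Pinf) hκ hS hI hD
  rw [betaPrime510_eq_mul] at e
  refine e.trans (le_of_eq ?_)
  ring

/-- Hence `betaInf (betaMerged F ℰ ρ bV) (t,t,…) → secondMoment Π⁰_∞ 0 1` as `t → 0⁺`. [cite: Balaban1987RG1, (1.22) p.264 and (2.12)-(2.14) p.268] -/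
theorem tendsto_betaInf_betaMerged_const_limitMoment {γ κ θ C₅ C₉ ω : ℝ} {Λ : ℕ → ℕ → ℝ} (hγ : 0 < γ) (hκ : 0 < κ) (h9 : NE9 (EA F ℰ ρ bV) (Window γ) κ Λ)
    (hF : T4OutputRate.FadingMemory C₉ ω Λ) (hω0 : 0 ≤ ω) (hω1 : ω < 1) (h18 : KernelStepRate F ℰ ρ bV γ κ θ C₅) (hθ0 : 0 ≤ θ) (hθ1 : θ < 1)
    (hdec : KernelDecay F ℰ ρ bV (Window γ) 0 1 κ) {P0 : ℕ → B12Beta.Kernel 4}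
    (hP : ∀ (k : ℕ) (μ ν : Fin 4) (z : Fin 4 → ℤ), Tendsto (fun t : ℝ => kernelA F ℰ ρ bV (fun _ : ℕ => t) k μ ν z) (𝓝[>] (0 : ℝ)) (𝓝 (P0 k μ ν z)))
    {Pinf : B12Beta.Kernel 4} (hPinf : ∀ (μ ν : Fin 4) (z : Fin 4 → ℤ), Tendsto (fun k : ℕ => P0 k μ ν z) atTop (𝓝 (Pinf μ ν z))) :
    Tendsto (fun t : ℝ => betaInf (betaMerged F ℰ ρ bV) (fun _ : ℕ => t)) (𝓝[>] (0 : ℝ)) (𝓝 (secondMoment Pinf 0 1)) := by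
  have key : ∀ᶠ t in 𝓝[>] (0 : ℝ), ‖betaInf (betaMerged F ℰ ρ bV) (fun _ : ℕ => t) - secondMoment Pinf 0 1‖ ≤ (C₉ * ω * (1 - ω)⁻¹) * betaPrime510 4 1 κ * t := by
    filter_upwards [Ioc_mem_nhdsGT hγ] with t ht
    rw [Real.norm_eq_abs]
    exact abs_betaInf_betaMerged_const_sub_limitMoment_le F ℰ ρ bV hγ hκ h9 hF hω0 hω1 h18 hθ0 hθ1 hdec hP hPinf ht
  have h0 : Tendsto (fun t : ℝ => (C₉ * ω * (1 - ω)⁻¹) * betaPrime510 4 1 κ * t) (𝓝[>] (0 : ℝ)) (𝓝 0) := by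
    have h : Tendsto (fun t : ℝ => (C₉ * ω * (1 - ω)⁻¹) * betaPrime510 4 1 κ * t) (𝓝 (0 : ℝ)) (𝓝 ((C₉ * ω * (1 - ω)⁻¹) * betaPrime510 4 1 κ * 0)) :=
      (continuous_const.mul continuous_id).tendsto 0
    rw [mul_zero] at h
    exact h.mono_left nhdsWithin_le_nhds
  exact tendsto_sub_nhds_zero_iff.1 (squeeze_zero_norm' key h0)

/-- ★★ **THE ITERATED CORNER LIMITS OF THE MERGED β COMMUTE** (kernel road): under kernel NE9 + fading memory, N18's letter, the (5.10) clause on the window, `0 < κ`, `0 < γ` — if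
`β_{k+1}(t,…,t) → c_k` as `t → 0⁺` (g4 FILE 1∕2's CORNER NUMBERS, diagonal reading) and `c_k → c_∞` (g4 FILE 3∕4's corner limit number), then node U2's functional satisfies
`betaInf (betaMerged F ℰ ρ bV) (t,t,…) → c_∞` as `t → 0⁺`: `lim_{t→0⁺} lim_k β_{k+1}(t,…,t) = lim_k lim_{t→0⁺} β_{k+1}(t,…,t)`.  So the number K2's one bit signs (idea-7's `L_∞`, there from
N17 + an anchor at the β level) IS the UV corner value of `betaInf` of the merged β, reached here from the three kernel letters; its SIGN is NOT claimed.
[cite: Balaban1987RG1, (1.22) p.264, (2.12)-(2.14) p.268, (5.10) p.293 and p.255 (motivation)] -/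
theorem tendsto_betaInf_betaMerged_const_of_cornerNumbers {γ κ θ C₅ C₉ ω : ℝ} {Λ : ℕ → ℕ → ℝ} (hγ : 0 < γ) (hκ : 0 < κ) (h9 : NE9 (EA F ℰ ρ bV) (Window γ) κ Λ)
    (hF : T4OutputRate.FadingMemory C₉ ω Λ) (hω0 : 0 ≤ ω) (hω1 : ω < 1) (h18 : KernelStepRate F ℰ ρ bV γ κ θ C₅) (hθ0 : 0 ≤ θ) (hθ1 : θ < 1)
    (hdec : KernelDecay F ℰ ρ bV (Window γ) 0 1 κ) {c : ℕ → ℝ} {cinf : ℝ}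
    (hc : ∀ k : ℕ, Tendsto (fun t : ℝ => betaMerged F ℰ ρ bV k (fun _ : Fin (k + 1) => t)) (𝓝[>] (0 : ℝ)) (𝓝 (c k)))
    (hcinf : Tendsto c atTop (𝓝 cinf)) :
    Tendsto (fun t : ℝ => betaInf (betaMerged F ℰ ρ bV) (fun _ : ℕ => t)) (𝓝[>] (0 : ℝ)) (𝓝 cinf) := by
  -- g4 FILE 3: corner kernels (band), their step from N18's letter, the limit kernel with its rate
  obtain ⟨P0, hP, hband⟩ := exists_cornerKernels_of_ne9 F ℰ ρ bV hγ h9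
  have hstep := abs_cornerKernel_step_le_of_kernelStepRate F ℰ ρ bV hγ h18 hP
  obtain ⟨Pinf, hinf⟩ := exists_limitKernel_of_cornerStep hθ1 hstep
  -- the corner numbers are the second moments of the corner kernels, which converge to the second moment of the limit kernel; so `cinf` is that number
  have hck : ∀ k : ℕ, c k = secondMoment (P0 k) 0 1 := cornerNumber_eq_secondMoment_cornerKernel F ℰ ρ bV hγ hκ hdec hband hc
  have hconv : Tendsto (fun k : ℕ => secondMoment (P0 k) 0 1) atTop (𝓝 (secondMoment Pinf 0 1)) := by
    have key : ∀ k : ℕ, ‖secondMoment (P0 k) 0 1 - secondMoment Pinf 0 1‖ ≤ (C₅ / (1 - θ) * betaPrime510 4 1 κ * θ) * θ ^ k := fun k => by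
      rw [Real.norm_eq_abs]
      refine (abs_cornerMoment_sub_limitMoment_le F ℰ ρ bV hγ hκ hdec hband (fun k z => (hinf 0 1 z).2 k) k).trans (le_of_eq ?_)
      ring
    have h0 : Tendsto (fun k : ℕ => (C₅ / (1 - θ) * betaPrime510 4 1 κ * θ) * θ ^ k) atTop (𝓝 0) := by
      have := (tendsto_pow_atTop_nhds_zero_of_lt_one hθ0 hθ1).const_mul (C₅ / (1 - θ) * betaPrime510 4 1 κ * θ)
      rwa [mul_zero] at this
    exact tendsto_sub_nhds_zero_iff.1 (squeeze_zero_norm' (Eventually.of_forall key) h0)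
  have hceq : cinf = secondMoment Pinf 0 1 := by
    refine tendsto_nhds_unique hcinf ?_
    exact hconv.congr fun k => (hck k).symm
  rw [hceq]
  exact tendsto_betaInf_betaMerged_const_limitMoment F ℰ ρ bV hγ hκ h9 hF hω0 hω1 h18 hθ0 hθ1 hdec hP (fun μ ν z => (hinf μ ν z).1)
/-! ## §6 At the record, Stage 13 (K3⁷ v5 pin currency): the stationary kernel of the merged term family OF RECORD from N18's letter of record `KernelStepRateOfRecord₁₃`,
§2b (i)'s kernel NE9 `h9`, (iii)'s (5.10) clause `hdec`, the letter signs -/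

section Record

open scoped Matrix.Norms.L2Operator

variable (N : ℕ) [NeZero N]

/-- ★★ **THE STATIONARY KERNEL OF RECORD** — for a Stage-13 `θ`, a letter block `ℓ` with `ℓ.Signs` and `0 < ℓ.κ`, kernel NE9 of the functional of record `(objectsOfRecord₁₃ F N θ ℓ).EA 0` on
`]0,θ.γ]^ℕ` at `(ℓ.κ, ℓ.moduli)` (§2b (i)'s `h9` VERBATIM), the (5.10) clause of record `KernelDecayOfRecord₁₃ F N θ 0 1 ℓ.κ` ((iii)'s `hdec`) and N18's letter of record
`KernelStepRateOfRecord₁₃ F N θ ℓ.κ ℓ.θ₅ ℓ.C₅` (g2's `n18At_rateCarriers_of_kernels_pin_iff_letter`: EXACTLY the N18 conjunct under the pin): there is ONE kernel functional `Π_∞` of the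
box-valued reversed history such that, for every `h ∈ ]0,θ.γ]^ℕ`, the merged (1.21) kernels of record along `revHist h k` converge to `Π_∞(h)` with tail `ℓ.C₅ℓ.θ₅^{k+1}e^{−ℓ.κ|z|₁}∕(1−ℓ.θ₅)`,
`Π_∞(h)` is (5.10)-class at `ℓ.κ`, has the memory profile `e^{−ℓ.κ|z|₁}·ℓ.C₉ℓ.ω·Σ'_j ℓ.ω^j|h j − h′ j|`, and ★ THE β OF RECORD satisfies (1.22) AT LEVEL ∞:
`betaOfRecord₁₃ F N θ k (revHist h k) → secondMoment (Π_∞ h) 0 1 = betaInf (betaOfRecord₁₃ F N θ) h`.  LOCATED: the three kernel letters displayed, inhabited at no θ here; N18 ∕ N22 ∕ (D4)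
NOT discharged; `stub_rates13H` NOT proved. [cite: Balaban1987RG1, Thm 1 p.259, (1.20)-(1.22) p.264, §5 p.298 and (5.10) p.293] -/
theorem stationaryKernel_record_of_kernelLetters (θ : Stage13Params F N) (ℓ : U3Letters₁₁) (hs : ℓ.Signs) (hκ : 0 < ℓ.κ)
    (h9 : NE9 ((objectsOfRecord₁₃ F N θ ℓ).EA 0) (Window θ.γ) ℓ.κ ℓ.moduli) (hdec : KernelDecayOfRecord₁₃ F N θ 0 1 ℓ.κ)
    (h18 : KernelStepRateOfRecord₁₃ F N θ ℓ.κ ℓ.θ₅ ℓ.C₅) :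
    letI := θ.instVβ₁; letI := θ.instVβ₂; letI := θ.instιβ
    ∃ Pst : (ℕ → ℝ) → B12Beta.Kernel 4, ∀ h : ℕ → ℝ, SeqBox θ.γ h →
      (∀ (μ ν : Fin 4) (z : Fin 4 → ℤ),
        Tendsto (fun k : ℕ => kernelA F (mergedTermFamilyMatT F N (TβOfRecord₁₃ F N) (chiβOfRecord₁₃ F N θ) θ.εbg) θ.ρ8 θ.bV (extd (revHist h k)) k μ ν z) atTop
          (𝓝 (Pst h μ ν z))) ∧
      (∀ (μ ν : Fin 4) (z : Fin 4 → ℤ) (k : ℕ),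
        |kernelA F (mergedTermFamilyMatT F N (TβOfRecord₁₃ F N) (chiβOfRecord₁₃ F N θ) θ.εbg) θ.ρ8 θ.bV (extd (revHist h k)) k μ ν z - Pst h μ ν z| ≤
          ℓ.C₅ * ℓ.θ₅ ^ (k + 1) * Real.exp (-(ℓ.κ * l1 z)) / (1 - ℓ.θ₅)) ∧
      (∃ C : ℝ, Decay510 (Pst h 0 1) C ℓ.κ) ∧
      (∀ h' : ℕ → ℝ, SeqBox θ.γ h' → ∀ (μ ν : Fin 4) (z : Fin 4 → ℤ),
        |Pst h μ ν z - Pst h' μ ν z| ≤ (Real.exp (-(ℓ.κ * l1 z)) * ℓ.C₉ * ℓ.ω) * ∑' j, ℓ.ω ^ j * |h j - h' j|) ∧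
      Tendsto (fun k : ℕ => betaOfRecord₁₃ F N θ k (revHist h k)) atTop (𝓝 (secondMoment (Pst h) 0 1)) ∧
      betaInf (betaOfRecord₁₃ F N θ) h = secondMoment (Pst h) 0 1 := by
  letI := θ.instVβ₁; letI := θ.instVβ₂; letI := θ.instιβ
  have hF : T4OutputRate.FadingMemory ℓ.C₉ ℓ.ω ℓ.moduli := fun a i _ => ⟨hs.moduli_nonneg a i, le_rfl⟩
  refine ⟨fun h μ ν z => betaInf (fun k v => kernelA F (mergedTermFamilyMatT F N (TβOfRecord₁₃ F N) (chiβOfRecord₁₃ F N θ) θ.εbg) θ.ρ8 θ.bV (extd v) k μ ν z) h,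
    fun h hh => ⟨fun μ ν z => ?_, fun μ ν z k => ?_, ?_, fun h' hh' μ ν z => ?_, ?_, ?_⟩⟩
  · exact tendsto_kernelEntry_revHist_stationary F _ θ.ρ8 θ.bV h18 hs.θ₅_lt_one hh μ ν z
  · exact abs_kernelEntry_revHist_sub_stationary_le F _ θ.ρ8 θ.bV h18 hs.θ₅_lt_one hh μ ν z k
  · exact exists_decay510_stationaryKernel_of_kernelDecay F _ θ.ρ8 θ.bV h18 hs.θ₅_lt_one hdec hh
  · exact memoryProfile_stationaryKernel_of_ne9 F _ θ.ρ8 θ.bV h18 hs.θ₅_lt_one h9 hF hs.ω_nonneg hs.ω_lt_one μ ν z h h' hh hh'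
  · exact (tendsto_betaMerged_revHist_secondMoment_stationaryKernel F _ θ.ρ8 θ.bV hκ h18 hs.θ₅_pos.le hs.θ₅_lt_one hdec hh).congr
      fun k => (Node00.betaOfMerged_of_mem _ _ _ (revHist_mem_box hh k)).symm
  · exact ((tendsto_betaMerged_revHist_secondMoment_stationaryKernel F _ θ.ρ8 θ.bV hκ h18 hs.θ₅_pos.le hs.θ₅_lt_one hdec hh).congr
      fun k => (Node00.betaOfMerged_of_mem _ _ _ (revHist_mem_box hh k)).symm).limUnder_eq

/-- ★★ **AT THE RECORD THE ITERATED CORNER LIMITS OF THE β OF RECORD COMMUTE** (`0 < θ.γ`; same three letters): if `betaOfRecord₁₃ F N θ k (t,…,t) → c_k` as `t → 0⁺` and `c_k → c_∞` (g4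
FILE 3's `cornerNumbers_record_geometric_of_kernelLetters` produces such `c`, `c_∞` with a geometric rate), then `betaInf (betaOfRecord₁₃ F N θ) (t,t,…) → c_∞` as `t → 0⁺` — the corner
limit number of the β of record IS the UV corner value of node U2's continuum functional of the β of record.  Its VALUE ∕ SIGN is NOT claimed; nothing of Bałaban asserted.
[cite: Balaban1987RG1, (1.22) p.264, (2.12)-(2.14) p.268, (5.10) p.293 and p.255 (motivation)] -/
theorem tendsto_betaInf_betaOfRecord₁₃_const_of_cornerNumbers (θ : Stage13Params F N) (ℓ : U3Letters₁₁) (hs : ℓ.Signs) (hγ : 0 < θ.γ) (hκ : 0 < ℓ.κ)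
    (h9 : NE9 ((objectsOfRecord₁₃ F N θ ℓ).EA 0) (Window θ.γ) ℓ.κ ℓ.moduli) (hdec : KernelDecayOfRecord₁₃ F N θ 0 1 ℓ.κ)
    (h18 : KernelStepRateOfRecord₁₃ F N θ ℓ.κ ℓ.θ₅ ℓ.C₅) {c : ℕ → ℝ} {cinf : ℝ}
    (hc : ∀ k : ℕ, Tendsto (fun t : ℝ => betaOfRecord₁₃ F N θ k (fun _ : Fin (k + 1) => t)) (𝓝[>] (0 : ℝ)) (𝓝 (c k))) (hcinf : Tendsto c atTop (𝓝 cinf)) :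
    Tendsto (fun t : ℝ => betaInf (betaOfRecord₁₃ F N θ) (fun _ : ℕ => t)) (𝓝[>] (0 : ℝ)) (𝓝 cinf) := by
  letI := θ.instVβ₁; letI := θ.instVβ₂; letI := θ.instιβ
  have hF : T4OutputRate.FadingMemory ℓ.C₉ ℓ.ω ℓ.moduli := fun a i _ => ⟨hs.moduli_nonneg a i, le_rfl⟩
  -- the corner numbers in the merged-β currency (on the box the β of record IS the merged β)
  have hc' : ∀ k : ℕ, Tendsto (fun t : ℝ => betaMerged F (mergedTermFamilyMatT F N (TβOfRecord₁₃ F N) (chiβOfRecord₁₃ F N θ) θ.εbg) θ.ρ8 θ.bV k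
      (fun _ : Fin (k + 1) => t)) (𝓝[>] (0 : ℝ)) (𝓝 (c k)) := fun k => by
    refine (hc k).congr' ?_
    filter_upwards [Ioc_mem_nhdsGT hγ] with t ht
    exact Node00.betaOfMerged_of_mem _ _ _ (const_mem_box ht)
  have h := tendsto_betaInf_betaMerged_const_of_cornerNumbers F _ θ.ρ8 θ.bV hγ hκ h9 hF hs.ω_nonneg hs.ω_lt_one h18 hs.θ₅_pos.le hs.θ₅_lt_one hdec hc' hcinf
  refine h.congr' ?_
  filter_upwards [Ioc_mem_nhdsGT hγ] with t ht
  have hh : SeqBox θ.γ (fun _ : ℕ => t) := fun _ => ht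
  show limUnder atTop _ = limUnder atTop _
  congr 1
  funext k
  exact (Node00.betaOfMerged_of_mem _ _ _ (revHist_mem_box hh k)).symm

end Record

end YMDAG.N18.StationaryKernelOfKernelLetters

end
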